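import Literature.AnabelianGeometry.EtaleTheta.Discharge.Sec2TwistedModelTheta
import Literature.AnabelianGeometry.SemiGraphs.ProfiniteCompletionEta
import HarnessLib

/-!
# The TWISTED NV-L2 model of `ThetaCovers.TemperedCoverData` ([EtTh] §2, Def. 2.5), part 3: the tempered layer
# `Π^tp_C = B × ℤ ↪ Π_C = B × Ẑ`, the coverings `Y`, `Ÿ`, `Ċ`, and the cusp stabiliser `N_{Π^tp_C}(tp D_x)`

S. Mochizuki, *The étale theta function …*, Publ. RIMS **45** (2009) [MochizukiEtTh2009], §2, Def. 2.5 pp.39–40, Cor. 2.9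
p.43 (PDF).  abc-iut cell, block F (fact-proving wave), seat abc-iut-f-142 (FACT-LIST row F-0601
`TemperedCoverData.Cor29_preserved`).  CONSISTENCY WITNESS / TOY (continuation of `ThetaCoversTwistedModelDefs.lean` and
`Discharge/Sec2TwistedModelTheta.lean`, same honest labels); PROOF-ONLY (0 definitions).

THE TEMPERED LAYER (as in abc-iut-w5-d118's NV-L2 model, with the twisted finite factor `B`): `Π^tp_C := B × ℤ` (discrete),
`Π^tp_C ↪ Π_C = B × Ẑ` = `id_B × η_ℤ` — injective and a profinite completion in abc-iut-L3's sense (`B` finite is its own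
completion; abc-iut-L2-t1's `isProfiniteCompletion_of_eta` for `ℤ`; `IsProfiniteCompletion.prodMap`); `Π^tp_X = B_X × ℤ`;
`Π^tp_Y := B_X × {0}`; `Π^tp_Ÿ := (B_X ∩ Ker two) × {0}`; `Π^tp_Ċ := Ker(two) × ℤ`.
THE CUSP DATA (new): `tp D_x = ⟨g₀⟩`, `g₀ = (m₀, 1)`, and its normaliser — the cusp stabiliser `cuspStabC` of [EtTh] Cor. 2.9
as typed — is EXACTLY `Φ⁻¹((ℤ/l × ℤ/l) ⋊ 1)` (trivial `D_l`-part): a proper NORMAL subgroup of `Π^tp_C`; the tempered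
`Π^tp_{C̲} = Φ⁻¹((ℤ/l × ℤ/l) ⋊ {1, s})`, `Π^tp_{X̲} = Φ⁻¹((ℤ/l × ℤ/l) ⋊ 1)`, `Π^tp_X = Φ⁻¹(heisPiX)`; an element
normalising `Π^tp_{C̲}` has `D_l`-part `1` or `s`.  [cite: MochizukiEtTh2009, Def 2.5 p.39] [cite: MochizukiEtTh2009, Cor 2.9 p.43]
-/

noncomputable section

namespace Literature.AnabelianGeometry.EtaleTheta

namespace ThetaCovers

namespace TwistedModel

open Multiplicative HeisenbergWitness Literature.AnabelianGeometry.SemiGraphs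
  Literature.AnabelianGeometry.EtaleTheta.SettingModel TemperedModel

variable (l : ℕ) [NeZero l]

/-! ## 1. Subgroups of `Π^tp_C = B × ℤ` and the embedding `Π^tp_C ↪ Π_C` -/

omit [NeZero l] in
/-- `B_X` is normal (index `2`). (toy bookkeeping) [cite: MochizukiEtTh2009, Def 2.5 p.39] -/
theorem TBX_normal : (TBX l).Normal := by
  haveI : (heisPiX l).Normal := MonoidHom.normal_ker _
  exact Subgroup.Normal.comap inferInstance _

omit [NeZero l] in
/-- Pull-backs along `Π^tp_C ↪ Π_C` of `Φ`-preimages are `Φ^tp`-preimages. (toy bookkeeping) [cite: MochizukiEtTh2009, Def 2.5 p.39] -/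
theorem comap_toHatB_comap_PhiB (H : Subgroup (heisPiC l)) :
    (H.comap (PhiB l)).comap (toHatB l).toMonoidHom = H.comap (PhiG l) := by
  rw [Subgroup.comap_comap]; rfl

omit [NeZero l] in
/-- **`Π^tp_X = B_X × ℤ`**: the inverse image of `Π_X ⊆ Π_C` in `Π^tp_C`. (toy bookkeeping) [cite: MochizukiEtTh2009, Def 2.5 p.39] -/
theorem comap_toHatB_PiXB : (PiXB l).comap (toHatB l).toMonoidHom = (TBX l).prod ⊤ := by
  ext ⟨a, n⟩
  rw [Subgroup.mem_prod]
  change TB.heis l a ∈ heisPiX l ↔ a ∈ TBX l ∧ n ∈ (⊤ : Subgroup (Multiplicative ℤ))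
  exact ⟨fun h => ⟨h, trivial⟩, fun h => h.1⟩

omit [NeZero l] in
/-- Membership in `Π^tp_X = B_X × ℤ`. (toy bookkeeping) [cite: MochizukiEtTh2009, Def 2.5 p.39] -/
theorem mem_comap_toHatB_PiXB (x : GtpB l) : x ∈ (PiXB l).comap (toHatB l).toMonoidHom ↔ x.1 ∈ TBX l := by
  rw [comap_toHatB_PiXB, Subgroup.mem_prod]
  exact ⟨fun h => h.1, fun h => ⟨h, trivial⟩⟩

omit [NeZero l] in
/-- **`Π^tp_C ↪ Π_C` is injective** (`η_ℤ` is). (toy bookkeeping) [cite: MochizukiEtTh2009, Def 2.5 p.39] -/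
theorem toHatB_injective : Function.Injective (toHatB l) := by
  intro x y h
  have h1 : (toHatB l x).1 = (toHatB l y).1 := congrArg Prod.fst h
  have h2 : (toHatB l x).2 = (toHatB l y).2 := congrArg Prod.snd h
  exact Prod.ext h1 (etaCont_int_injective h2)

/-- The finite discrete group `B` is its own profinite completion (identity map). (toy bookkeeping)
[cite: MochizukiEtTh2009, Def 2.5 p.39] -/
theorem isProfiniteCompletion_id_TB : IsProfiniteCompletion (ContinuousMonoidHom.id (TB l)) where
  compactSpace := inferInstance
  t2Space := inferInstance
  totallyDisconnectedSpace := inferInstance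
  denseRange := denseRange_id
  comap_surjective U _ := ⟨U, by ext; rfl⟩
  isOpen_comap V := V.isOpen'

/-- **`Π^tp_C ↪ Π_C` is a profinite completion** in abc-iut-L3's sense (product of `id_B` and `η_ℤ`). (toy bookkeeping)
[cite: MochizukiEtTh2009, Def 2.5 p.39] -/
theorem isProfiniteCompletion_toHatB : IsProfiniteCompletion (toHatB l) :=
  (isProfiniteCompletion_id_TB l).prodMap
    (isProfiniteCompletion_of_eta (etaCont (Multiplicative ℤ)) fun _ => rfl)

omit [NeZero l] in
/-- **`Π^tp_X / Π^tp_Y ≅ ℤ`** for `Π^tp_Y := B_X × {0}` (the Tate quotient `Z`, p.39). (toy bookkeeping)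
[cite: MochizukiEtTh2009, Def 2.5 p.39] -/
theorem nonempty_quotZ [((TBX l).prod (⊥ : Subgroup (Multiplicative ℤ))).Normal] :
    Nonempty (↥((PiXB l).comap (toHatB l).toMonoidHom) ⧸
      (((TBX l).prod (⊥ : Subgroup (Multiplicative ℤ))).subgroupOf ((PiXB l).comap (toHatB l).toMonoidHom)) ≃*
        Multiplicative ℤ) := by
  let K : Subgroup (GtpB l) := (PiXB l).comap (toHatB l).toMonoidHom
  let f : ↥K →* Multiplicative ℤ := (MonoidHom.snd _ _).comp (Subgroup.subtype _)
  have hf : Function.Surjective f := fun n =>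
    ⟨⟨(1, n), (mem_comap_toHatB_PiXB l _).mpr (TBX l).one_mem⟩, rfl⟩
  have hker : f.ker = ((TBX l).prod (⊥ : Subgroup (Multiplicative ℤ))).subgroupOf K := by
    ext ⟨⟨a, n⟩, ha⟩
    rw [MonoidHom.mem_ker, Subgroup.mem_subgroupOf, Subgroup.mem_prod, Subgroup.mem_bot]
    exact ⟨fun h => ⟨(mem_comap_toHatB_PiXB l _).mp ha, h⟩, fun h => h.2⟩
  exact ⟨(QuotientGroup.quotientMulEquivOfEq hker.symm).trans (QuotientGroup.quotientKerEquivOfSurjective f hf)⟩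

omit [NeZero l] in
/-- **`[Π^tp_Y : Π^tp_Ÿ] = 2`** for `Π^tp_Ÿ := (B_X ∩ Ker two) × {0}` (the `ℤ/2`-coordinate). (toy bookkeeping)
[cite: MochizukiEtTh2009, Def 2.5 p.40] -/
theorem relIndex_PiYddtp : (((TBX l ⊓ (TB.two l).ker)).prod (⊥ : Subgroup (Multiplicative ℤ))).relIndex
    ((TBX l).prod ⊥) = 2 := by
  let g : ↥((TBX l).prod (⊥ : Subgroup (Multiplicative ℤ))) →* Multiplicative (ZMod 2) :=
    (TB.two l).comp ((MonoidHom.fst _ _).comp (Subgroup.subtype _))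
  have hg : Function.Surjective g := fun y =>
    ⟨⟨(TB.inH l 1 y, 1), ⟨show TB.heis l (TB.inH l 1 y) ∈ heisPiX l from by
      rw [TB.heis_inH]; exact (heisPiX l).one_mem, rfl⟩⟩, rfl⟩
  have hker : g.ker = (((TBX l ⊓ (TB.two l).ker)).prod (⊥ : Subgroup (Multiplicative ℤ))).subgroupOf
      ((TBX l).prod ⊥) := by
    ext ⟨⟨a, n⟩, ha⟩
    rw [MonoidHom.mem_ker, Subgroup.mem_subgroupOf, Subgroup.mem_prod, Subgroup.mem_inf, MonoidHom.mem_ker]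
    exact ⟨fun h => ⟨⟨ha.1, h⟩, ha.2⟩, fun h => h.1.2⟩
  change ((((TBX l ⊓ (TB.two l).ker)).prod (⊥ : Subgroup (Multiplicative ℤ))).subgroupOf ((TBX l).prod ⊥)).index = 2
  rw [← hker, Subgroup.index_ker, MonoidHom.range_eq_top.mpr hg, Subgroup.card_top, Nat.card_eq_fintype_card,
    Fintype.card_multiplicative, ZMod.card]

omit [NeZero l] in
/-- **`[Π^tp_C : Π^tp_Ċ] = 2`** for `Π^tp_Ċ := Ker(two) × ℤ`. (toy bookkeeping) [cite: MochizukiEtTh2009, Def 2.5 p.39] -/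
theorem index_PiCdot : (((TB.two l).ker).prod (⊤ : Subgroup (Multiplicative ℤ))).index = 2 := by
  have hsurj : Function.Surjective (TB.two l) := fun y => ⟨TB.inH l 1 y, rfl⟩
  rw [Subgroup.index_prod, Subgroup.index_top, mul_one, Subgroup.index_ker, MonoidHom.range_eq_top.mpr hsurj,
    Subgroup.card_top, Nat.card_eq_fintype_card, Fintype.card_multiplicative, ZMod.card]

omit [NeZero l] in
/-- `Π^tp_Ċ ≠ Π^tp_X` (the element `((s, 1), 0)`). (toy bookkeeping) [cite: MochizukiEtTh2009, Def 2.5 p.39] -/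
theorem PiCdot_ne : ((TB.two l).ker).prod (⊤ : Subgroup (Multiplicative ℤ)) ≠ (PiXB l).comap (toHatB l).toMonoidHom := by
  intro h
  have hw : iotaG l ∈ ((TB.two l).ker).prod (⊤ : Subgroup (Multiplicative ℤ)) := ⟨rfl, trivial⟩
  rw [h, mem_comap_toHatB_PiXB] at hw
  obtain ⟨i, hi⟩ := (mem_heisPiX l).mp hw
  cases hi

/-! ## 2. `K ⊇ μ_l` in the model -/

/-- **`K ⊇ μ_l` holds in the twisted model** (`HasMuL`: all of `Π_C` centralises `Δ̄_Θ` modulo `Ker`) — so [EtTh] Cor. 2.9's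
statements are NOT vacuously true there. (toy bookkeeping) [cite: MochizukiEtTh2009, Cor 2.9 p.43] -/
theorem hasMuL_model (hl : Odd l) (c : PiCB l) {t : PiCB l} (ht : t ∈ barThetaB l) :
    c * t * c⁻¹ * t⁻¹ ∈ barKerB l := by
  refine ⟨?_, PsiB_comm_mem_ker l c t⟩
  change PhiB l (c * t * c⁻¹ * t⁻¹) ∈ heisTheta l
  rw [map_mul, map_mul, map_mul, map_inv, map_inv, heis_theta_central l hl (PhiB l c) ht]
  exact (heisTheta l).one_mem

/-! ## 3. The tempered members `Π^tp_{C̲}`, `Π^tp_{X̲}`, `Π^tp_X` and `tp D_x` of the model -/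

/-- **`Π^tp_{C̲} = Φ^tp⁻¹((ℤ/l × ℤ/l) ⋊ {1, s})`** (`Π_{C̲} = Π_{C̲̲} · Δ̄_Θ-preimage = Φ⁻¹(heisPiCu)`). (toy bookkeeping)
[cite: MochizukiEtTh2009, Def 2.5 p.39] -/
theorem tp_PiCu : (PiCuuB l ⊔ barThetaB l).comap (toHatB l).toMonoidHom = (heisPiCu l).comap (PhiG l) := by
  rw [PiCuuB_sup_barThetaB, HpB, comap_toHatB_comap_PhiB]

/-- **`Π^tp_{X̲} = Φ^tp⁻¹((ℤ/l × ℤ/l) ⋊ 1)`** (`Π_{X̲} = (Π_{C̲̲} ∩ Π_X) · Δ̄_Θ-preimage`). (toy bookkeeping)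
[cite: MochizukiEtTh2009, Def 2.5 p.39] -/
theorem tp_PiXu : ((PiCuuB l ⊓ PiXB l) ⊔ barThetaB l).comap (toHatB l).toMonoidHom =
    (heisPiCu l ⊓ heisPiX l).comap (PhiG l) := by
  rw [PiXuuB_sup_barThetaB, HpB_inf_eq, comap_toHatB_comap_PhiB]

omit [NeZero l] in
/-- **`Π^tp_X = Φ^tp⁻¹(heisPiX)`**. (toy bookkeeping) [cite: MochizukiEtTh2009, Def 2.5 p.39] -/
theorem tp_PiX : (PiXB l).comap (toHatB l).toMonoidHom = (heisPiX l).comap (PhiG l) :=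
  comap_toHatB_comap_PhiB l _

omit [NeZero l] in
/-- **`tp D_x = ⟨g₀⟩`**, `g₀ = (m₀, 1) ∈ B × ℤ` (`Π^tp_C ↪ Π_C` is injective). (toy bookkeeping) [cite: MochizukiEtTh2009, Cor 2.9 p.43] -/
theorem tp_Dx : (DxB l).comap (toHatB l).toMonoidHom = Subgroup.zpowers (genG l) := by
  rw [DxB, ← toHatB_genG, show (toHatB l) (genG l) = (toHatB l).toMonoidHom (genG l) from rfl,
    ← MonoidHom.map_zpowers, Subgroup.comap_map_eq_self_of_injective (toHatB_injective l)]

/-! ## 4. The cusp stabiliser `N_{Π^tp_C}(⟨g₀⟩) = Φ^tp⁻¹((ℤ/l × ℤ/l) ⋊ 1)` -/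

omit [NeZero l] in
/-- Conjugating a translation of `M` inside `M ⋊ heisPiC l`: `x · m · x⁻¹ = h(x)·m` (`M` is commutative). (toy bookkeeping)
[cite: MochizukiEtTh2009, Cor 2.9 p.43] -/
theorem TH_conj_inl (x : TH l) (m : Multiplicative (ZMod l × ZMod l)) :
    x * SemidirectProduct.inl m * x⁻¹ = SemidirectProduct.inl (rho l x.right m) := by
  refine SemidirectProduct.ext ?_ ?_
  · simp only [SemidirectProduct.mul_left, SemidirectProduct.mul_right, SemidirectProduct.left_inl,
      SemidirectProduct.right_inl, mul_one, SemidirectProduct.inv_left, map_inv, MulAut.apply_inv_self]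
    rw [mul_comm x.left, mul_assoc, mul_inv_cancel, mul_one]
  · simp

omit [NeZero l] in
/-- `theta d` fixes `m₀ = (1, 0)` only for `d = 1` (`l ≥ 3`: `−1 ≠ 1`). (toy bookkeeping) [cite: MochizukiEtTh2009, Cor 2.9 p.43] -/
theorem theta_gen_eq_iff (h3 : 3 ≤ l) (d : DihedralGroup l) :
    theta l d (ofAdd ((1 : ZMod l), (0 : ZMod l))) = ofAdd ((1 : ZMod l), (0 : ZMod l)) ↔ d = 1 := by
  haveI : Fact (2 < l) := ⟨h3⟩
  constructor
  · intro h
    have h1 := congrArg (fun x => (toAdd x).1) h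
    have h2 := congrArg (fun x => (toAdd x).2) h
    simp only [toAdd_theta_fst, toAdd_theta_snd, toAdd_ofAdd, mul_one, zero_add] at h1 h2
    rcases d with i | i
    · rw [rotIdx_r] at h2
      rw [h2, DihedralGroup.one_def]
    · rw [eps_sr] at h1
      exact absurd h1 ZMod.neg_one_ne_one
  · rintro rfl
    rw [map_one, MulAut.one_apply]

omit [NeZero l] in
/-- `y · g₀ · y⁻¹ = g₀` iff the `D_l`-part of `y` is trivial. (toy bookkeeping) [cite: MochizukiEtTh2009, Cor 2.9 p.43] -/
theorem conj_genG_eq_iff (h3 : 3 ≤ l) (y : GtpB l) : y * genG l * y⁻¹ = genG l ↔ (PhiG l y).right = 1 := by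
  rw [← theta_gen_eq_iff l h3]
  have key : (y * genG l * y⁻¹).1.1 =
      SemidirectProduct.inl (theta l (PhiG l y).right (ofAdd ((1 : ZMod l), (0 : ZMod l)))) :=
    TH_conj_inl l y.1.1 _
  constructor
  · intro h
    rw [h] at key
    have key' : (SemidirectProduct.inl (ofAdd ((1 : ZMod l), (0 : ZMod l))) : TH l) =
        SemidirectProduct.inl (theta l (PhiG l y).right (ofAdd ((1 : ZMod l), (0 : ZMod l)))) := key
    exact (SemidirectProduct.inl_injective key').symm
  · intro h
    refine Prod.ext (Prod.ext ?_ ?_) ?_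
    · rw [key, h]
      rfl
    · change y.1.2 * 1 * y.1.2⁻¹ = 1
      rw [mul_one, mul_inv_cancel]
    · change y.2 * ofAdd (1 : ℤ) * y.2⁻¹ = ofAdd (1 : ℤ)
      rw [mul_inv_cancel_comm]

omit [NeZero l] in
/-- **The cusp stabiliser of the model**: `N_{Π^tp_C}(⟨g₀⟩) = Φ^tp⁻¹((ℤ/l × ℤ/l) ⋊ 1)` — the elements with trivial
`D_l`-part (`l ≥ 3`).  In particular it is a proper NORMAL subgroup, equal to `Π^tp_{X̲}`. (toy bookkeeping)
[cite: MochizukiEtTh2009, Cor 2.9 p.43] -/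
theorem normalizer_zpowers_genG (h3 : 3 ≤ l) :
    Subgroup.normalizer ((Subgroup.zpowers (genG l) : Subgroup (GtpB l)) : Set (GtpB l)) =
      (heisPiCu l ⊓ heisPiX l).comap (PhiG l) := by
  ext y
  rw [Subgroup.mem_comap, mem_heisPiCu_inf, ← conj_genG_eq_iff l h3]
  constructor
  · intro hy
    have hmem : y * genG l * y⁻¹ ∈ Subgroup.zpowers (genG l) :=
      (Subgroup.mem_normalizer_iff.mp hy (genG l)).mp (Subgroup.mem_zpowers _)
    obtain ⟨k, hk⟩ := Subgroup.mem_zpowers_iff.mp hmem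
    -- second coordinates: `(ofAdd 1)^k = n · ofAdd 1 · n⁻¹ = ofAdd 1` forces `k = 1`
    have h2 : (ofAdd (1 : ℤ)) ^ k = y.2 * ofAdd (1 : ℤ) * y.2⁻¹ := congrArg Prod.snd hk
    rw [mul_inv_cancel_comm, ← ofAdd_zsmul, smul_eq_mul, mul_one] at h2
    have hk1 : k = 1 := ofAdd.injective h2
    rw [hk1, zpow_one] at hk
    exact hk.symm
  · intro hy
    rw [Subgroup.mem_normalizer_iff_map_conj_eq, MonoidHom.map_zpowers, MonoidHom.coe_coe, MulAut.conj_apply, hy]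

end TwistedModel

end ThetaCovers

end Literature.AnabelianGeometry.EtaleTheta
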